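import Summits.QuantumFields.BalabanUV.Beta.D1BFx.RestTotalOfWords

/-!
# Road BF-x: the TOTAL off-corner rest bound FROM ONE BOUND PER IDENTITY-CLOSED GROUP OF WORDS — the glue by which the (Λ)-group and the
# NEEDLE-group rows feed the total-rest END `RoadEndBFxTotal.d1Drift_BFx_total` (owner SPEC «K-END-RESHAPE-GROUPS» v1 §3 (F1), road «BF-x», BINDER-OWNERS row D1)

HONEST DEPENDENCY (page 1, mandatory): continuum YM on T⁴ ⇐ BetaPertH ∧ nine spine estimates (0/9 proved); BetaPertH ⇐ (D1) ∧ (D4) ∧ CAP+tail;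
G-an2-4 gates asym, D1 and NE2/3/4.  HONEST STATUS: [folklore] bookkeeping; NO BOUND on any word or group is proved here — every group bound is a
displayed hypothesis; 0 wall binders; (K) NOT closed; D1 NOT discharged; NOT BetaPertH, NOT continuum, NOT Clay.

WHY (SPEC §1).  The per-word glue `RestTotalOfWords.hRestTot_of_hRest` (p226684) feeds the END's `hRestTot` from one n-uniform bound PER re-cut word
`τ ≠ cornerIdx`.  For the Λ⊗E words and the needle words such per-word bounds are false uniformly in `n` (individual words carry `log n`, resp. `n`);
only the sums over identity-closed GROUPS of words are bounded.  This file is the same glue with the word set partitioned by a label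
`grp : RestIdx → G` into finitely many groups, the corner being its own group `g₀` (`grp τ = g₀ ↔ τ = cornerIdx`), and ONE hypothesis per group `g ≠ g₀`
on the base-point average of the full sum of THE SUM OF THE WORDS OF THAT GROUP; conclusion: the END's `hRestTot` with `CRtot := Σ_{g ≠ g₀} CG g`.
Proof: regroup the finite word sum by `grp` (`Finset.sum_fiberwise_of_maps_to`), `fullSum` additivity over the finite set of groups
(`Assembly.fullSum_finset_sum`, each group sum convergent by `Assembly.exists_tendsto_psum_finset_sum` from the per-word (CONV) `AssemblyEndRecut.conv_recut`),
swap the two finite sums, triangle inequality.  The per-word glue is the special case `G := RestIdx`, `grp := id`, `g₀ := cornerIdx`.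

CONTENT.
* §1 [folklore] `restTot_of_groups` — at one block size, site-dependent profile (the (CONV) data of `conv_recut`).
* §2 [folklore] `hRestTot_of_hGroups` — packaged along `n ≥ 2` at the frozen profile `gfrz n a` and the pinned normalisation `n⁸`: group bounds for every
  `n ≥ 2` ⟹ the END's `hRestTot` verbatim (composable with `RoadEndBFxTotalShell.d1Drift_BFx_total_shell_of_prop12` as it stands);
  `hRestTotOdd_of_hGroupsOdd` — the same at ODD block sizes only (the SPEC's `∀ n ≥ 2, Odd n → ∀ g ≠ g₀, …` shape ⟹ `hRestTot` at odd `n`, for an END that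
  consumes the rest total only inside its `Odd n` defect callback).
No `def`, no `Prop` minted, nothing cited, 0 sorry.  Unit `b2b-balaban-gan24-formalise-leaf-05` (gen 40), G-an2-4 swarm leaf prover on cross-lane kernel duty
for road «BF-x» (SPEC §4: first refusal leaf-03 lineage, else gan24-leaf-05 lineage).
-/

noncomputable section

open Finset Filter Topology
open scoped BigOperators
open Literature.MathematicalPhysics.QuantumFieldTheory.Balaban1983to89
open Literature.MathematicalPhysics.QuantumFieldTheory.Balaban1983to89.Beta
open WindowIdentification (fullSum psum)
open B12Sec2to5 (l1)
open DyadicShell (Pt)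
open ExpKernelCalculus (Site MKer BiLoc)
open DressedMomentNormalisation (resSite)
open Summit.QuantumFields.BalabanUV.Beta.TameKernelCalculus (Spr)
open Summit.QuantumFields.BalabanUV.Beta.D1BFx.GluonLeg (Ga)
open Summit.QuantumFields.BalabanUV.Beta.D1BFx.ReducedKernel (TableR)
open Summit.QuantumFields.BalabanUV.Beta.D1BFx.FrozenLegProfile (gfrz decay_gfrz)
open Summit.QuantumFields.BalabanUV.Beta.D1BFx.SplitInstance (RestIdx)
open Summit.QuantumFields.BalabanUV.Beta.D1BFx.SplitRecut (restK')
open Summit.QuantumFields.BalabanUV.Beta.D1BFx.Assembly (fullSum_finset_sum exists_tendsto_psum_finset_sum)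
open Summit.QuantumFields.BalabanUV.Beta.D1BFx.AssemblyEndRecut (conv_recut)
open Summit.QuantumFields.BalabanUV.Beta.D1BFx.RoadEndBFxRecut (cornerIdx)

namespace Summit.QuantumFields.BalabanUV.Beta.D1BFx.RestTotalOfGroups

/-! ## §1 At one block size -/

section Fixed

variable (n : ℕ) [NeZero n] (a : ℝ) {gp : Pt → Pt → ℝ} (cE cΛ cR cK cQ cE₂ cJ4 cΛ₂ cR₂ cQ₂ x₀ ωgl ωgh lam N : ℝ) {WE WJ WΛ WR WQ : TableR}
  {μ ν : Fin 4} {CE CJ CΛt CRt CQ δW : ℝ} {G : Type*} [Fintype G] [DecidableEq G] {grp : RestIdx → G} {g₀ : G} {CG : G → ℝ}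

/-- [folklore] The off-corner word set is the union of the fibres of `grp` over the labels `g ≠ g₀`, when the corner is exactly the fibre of `g₀`. -/
theorem sum_erase_corner_eq_sum_fiberwise (hcorner : ∀ τ : RestIdx, grp τ = g₀ ↔ τ = cornerIdx) (f : RestIdx → ℝ) :
    ∑ τ ∈ (univ : Finset RestIdx).erase cornerIdx, f τ
      = ∑ g ∈ (univ : Finset G).erase g₀, ∑ τ ∈ (univ : Finset RestIdx).filter (fun τ => grp τ = g), f τ := by
  rw [← sum_fiberwise_of_maps_to (s := (univ : Finset RestIdx).erase cornerIdx) (t := (univ : Finset G).erase g₀) (g := grp)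
    (fun τ hτ => mem_erase.2 ⟨fun h => (mem_erase.1 hτ).1 ((hcorner τ).1 h), mem_univ _⟩)]
  refine sum_congr rfl fun g hg => sum_congr ?_ fun _ _ => rfl
  ext τ
  refine ⟨fun h => mem_filter.2 ⟨mem_univ _, (mem_filter.1 h).2⟩,
    fun h => mem_filter.2 ⟨mem_erase.2 ⟨fun hτc => ?_, mem_univ _⟩, (mem_filter.1 h).2⟩⟩
  exact (mem_erase.1 hg).1 ((mem_filter.1 h).2.symm.trans ((hcorner τ).2 hτc))

/-- [folklore] **GROUP BOUNDS IMPLY THE TOTAL OFF-CORNER BOUND** at a fixed block size (site-dependent profile `gp b` exponentially bounded; `0 < a`,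
`Spr (Ga n a)`, the five slot tables bi-localised at one rate, `μ ≠ ν` — the (CONV) data of `AssemblyEndRecut.conv_recut`): if the words are labelled by
`grp : RestIdx → G` with the corner exactly the fibre of `g₀`, and for every label `g ≠ g₀` the base-point average of the full sum of the SUM of the words
of fibre `g` is bounded by `CG g`, then the END's off-corner total is bounded by `Σ_{g ≠ g₀} CG g`. -/
theorem restTot_of_groups (ha : 0 < a) (hGa : Spr (Ga n a))
    (hg : ∀ b : Pt, ∃ C δ : ℝ, 0 < δ ∧ ∀ v, |gp b v| ≤ C * Real.exp (-δ * l1 v)) (hδW : 0 < δW)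
    (hE : ∀ κ u l u', BiLoc (WE κ u l u') u u' CE δW) (hJ : ∀ κ u l u', BiLoc (WJ κ u l u') u u' CJ δW)
    (hΛ : ∀ κ u l u', BiLoc (WΛ κ u l u') u u' CΛt δW) (hR : ∀ κ u l u', BiLoc (WR κ u l u') u u' CRt δW)
    (hQ : ∀ κ u l u', BiLoc (WQ κ u l u') u u' CQ δW) (hμν : μ ≠ ν)
    (hcorner : ∀ τ : RestIdx, grp τ = g₀ ↔ τ = cornerIdx)
    (hGrp : ∀ g : G, g ≠ g₀ → |∑ b ∈ (univ : Finset (Fin 4 → Fin n)).image resSite, ((n : ℝ) ^ 4)⁻¹ *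
      fullSum (fun w : Pt => ∑ τ ∈ (univ : Finset RestIdx).filter (fun τ => grp τ = g),
        restK' n a (gp b) cE cΛ cR cK cQ cE₂ cJ4 cΛ₂ cR₂ cQ₂ x₀ WE WJ WΛ WR WQ ωgl ωgh lam N μ ν b τ w)| ≤ CG g) :
    |∑ b ∈ (univ : Finset (Fin 4 → Fin n)).image resSite, ((n : ℝ) ^ 4)⁻¹ *
      fullSum (fun w : Pt => ∑ τ ∈ (univ : Finset RestIdx).erase cornerIdx,
        restK' n a (gp b) cE cΛ cR cK cQ cE₂ cJ4 cΛ₂ cR₂ cQ₂ x₀ WE WJ WΛ WR WQ ωgl ωgh lam N μ ν b τ w)|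
      ≤ ∑ g ∈ (univ : Finset G).erase g₀, CG g := by
  -- regroup the finite word sum by the label, distribute the full sum over the finite set of groups (every group sum converges), swap the two finite sums
  have hfs : ∀ b ∈ (univ : Finset (Fin 4 → Fin n)).image resSite,
      fullSum (fun w : Pt => ∑ τ ∈ (univ : Finset RestIdx).erase cornerIdx,
        restK' n a (gp b) cE cΛ cR cK cQ cE₂ cJ4 cΛ₂ cR₂ cQ₂ x₀ WE WJ WΛ WR WQ ωgl ωgh lam N μ ν b τ w)
      = ∑ g ∈ (univ : Finset G).erase g₀, fullSum (fun w : Pt => ∑ τ ∈ (univ : Finset RestIdx).filter (fun τ => grp τ = g),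
          restK' n a (gp b) cE cΛ cR cK cQ cE₂ cJ4 cΛ₂ cR₂ cQ₂ x₀ WE WJ WΛ WR WQ ωgl ωgh lam N μ ν b τ w) := by
    intro b _
    obtain ⟨C', δ', hδ', hgb⟩ := hg b
    have e : (fun w : Pt => ∑ τ ∈ (univ : Finset RestIdx).erase cornerIdx,
        restK' n a (gp b) cE cΛ cR cK cQ cE₂ cJ4 cΛ₂ cR₂ cQ₂ x₀ WE WJ WΛ WR WQ ωgl ωgh lam N μ ν b τ w)
        = fun w : Pt => ∑ g ∈ (univ : Finset G).erase g₀, ∑ τ ∈ (univ : Finset RestIdx).filter (fun τ => grp τ = g),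
          restK' n a (gp b) cE cΛ cR cK cQ cE₂ cJ4 cΛ₂ cR₂ cQ₂ x₀ WE WJ WΛ WR WQ ωgl ωgh lam N μ ν b τ w :=
      funext fun w => sum_erase_corner_eq_sum_fiberwise hcorner _
    rw [e]
    exact fullSum_finset_sum _ fun g _ => exists_tendsto_psum_finset_sum _ fun τ _ =>
      conv_recut n a cE cΛ cR cK cQ cE₂ cJ4 cΛ₂ cR₂ cQ₂ x₀ ωgl ωgh lam N b ha hGa hδ' hgb hδW hE hJ hΛ hR hQ hμν τ
  rw [sum_congr rfl fun b hb => by rw [hfs b hb, mul_sum], sum_comm]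
  refine (abs_sum_le_sum_abs _ _).trans (sum_le_sum fun g hg => ?_)
  exact hGrp g (ne_of_mem_erase hg)

end Fixed

/-! ## §2 Packaged along the block sizes, at the frozen profile and the pinned normalisation — both parities and odd only -/

section Packaged

variable {a N : ℝ} {μ ν : Fin 4} {cE cΛ cR cK cQ cE₂ cJ4 cΛ₂ cR₂ cQ₂ x₀ ωgl ωgh : ℕ → ℝ} {WE WJ WΛ WR WQ : ℕ → TableR}
  {CE CJ CΛt CRt CQ δW : ℕ → ℝ} {G : Type*} [Fintype G] [DecidableEq G] {grp : RestIdx → G} {g₀ : G} {CG : G → ℝ}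

/-- [folklore] **ONE n-UNIFORM BOUND PER GROUP `g ≠ g₀` IMPLIES THE `hRestTot` HYPOTHESIS OF `RoadEndBFxTotal.d1Drift_BFx_total`** (and of
`RoadEndBFxTotalShell.d1Drift_BFx_total_shell_of_prop12`) with `CRtot := Σ_{g ≠ g₀} CG g` (given the ENDs' common data `0 < a`, `Spr (Ga n a)`, the slot-table
localisation, `μ ≠ ν`, and the corner being exactly the fibre of `g₀`). -/
theorem hRestTot_of_hGroups (ha : 0 < a) (hμν : μ ≠ ν) (hGa : ∀ n : ℕ, 2 ≤ n → ∀ [NeZero n], Spr (Ga n a)) (hδW : ∀ n, 0 < δW n)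
    (hE : ∀ n κ u l u', BiLoc (WE n κ u l u') u u' (CE n) (δW n)) (hJ : ∀ n κ u l u', BiLoc (WJ n κ u l u') u u' (CJ n) (δW n))
    (hΛ : ∀ n κ u l u', BiLoc (WΛ n κ u l u') u u' (CΛt n) (δW n)) (hR : ∀ n κ u l u', BiLoc (WR n κ u l u') u u' (CRt n) (δW n))
    (hQ : ∀ n κ u l u', BiLoc (WQ n κ u l u') u u' (CQ n) (δW n))
    (hcorner : ∀ τ : RestIdx, grp τ = g₀ ↔ τ = cornerIdx)
    (hGrp : ∀ n : ℕ, 2 ≤ n → ∀ [NeZero n], ∀ g : G, g ≠ g₀ →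
      |∑ b ∈ (univ : Finset (Fin 4 → Fin n)).image resSite, ((n : ℝ) ^ 4)⁻¹ *
        fullSum (fun w : Pt => ∑ τ ∈ (univ : Finset RestIdx).filter (fun τ => grp τ = g),
          restK' n a (gfrz n a b) (cE n) (cΛ n) (cR n) (cK n) (cQ n) (cE₂ n) (cJ4 n) (cΛ₂ n) (cR₂ n) (cQ₂ n) (x₀ n)
            (WE n) (WJ n) (WΛ n) (WR n) (WQ n) (ωgl n) (ωgh n) ((n : ℝ) ^ 8) N μ ν b τ w)| ≤ CG g) :
    ∀ n : ℕ, 2 ≤ n → ∀ [NeZero n],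
      |∑ b ∈ (univ : Finset (Fin 4 → Fin n)).image resSite, ((n : ℝ) ^ 4)⁻¹ *
        fullSum (fun w : Pt => ∑ τ ∈ (univ : Finset RestIdx).erase cornerIdx,
          restK' n a (gfrz n a b) (cE n) (cΛ n) (cR n) (cK n) (cQ n) (cE₂ n) (cJ4 n) (cΛ₂ n) (cR₂ n) (cQ₂ n) (x₀ n)
            (WE n) (WJ n) (WΛ n) (WR n) (WQ n) (ωgl n) (ωgh n) ((n : ℝ) ^ 8) N μ ν b τ w)|
        ≤ ∑ g ∈ (univ : Finset G).erase g₀, CG g := by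
  intro n hn _
  exact restTot_of_groups n a (cE n) (cΛ n) (cR n) (cK n) (cQ n) (cE₂ n) (cJ4 n) (cΛ₂ n) (cR₂ n) (cQ₂ n) (x₀ n) (ωgl n) (ωgh n)
    ((n : ℝ) ^ 8) N ha (hGa n hn) (fun b => decay_gfrz (hGa n hn) b) (hδW n) (hE n) (hJ n) (hΛ n) (hR n) (hQ n) hμν hcorner (hGrp n hn)

/-- [folklore] **THE SAME AT ODD BLOCK SIZES ONLY** — the SPEC's shape `∀ n ≥ 2, Odd n → ∀ g ≠ g₀, …`: group bounds at odd `n` imply the off-corner rest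
total bound `≤ Σ_{g ≠ g₀} CG g` at odd `n` (for an END that consumes the rest total only inside its `Odd n` defect callback). -/
theorem hRestTotOdd_of_hGroupsOdd (ha : 0 < a) (hμν : μ ≠ ν) (hGa : ∀ n : ℕ, 2 ≤ n → ∀ [NeZero n], Spr (Ga n a)) (hδW : ∀ n, 0 < δW n)
    (hE : ∀ n κ u l u', BiLoc (WE n κ u l u') u u' (CE n) (δW n)) (hJ : ∀ n κ u l u', BiLoc (WJ n κ u l u') u u' (CJ n) (δW n))
    (hΛ : ∀ n κ u l u', BiLoc (WΛ n κ u l u') u u' (CΛt n) (δW n)) (hR : ∀ n κ u l u', BiLoc (WR n κ u l u') u u' (CRt n) (δW n))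
    (hQ : ∀ n κ u l u', BiLoc (WQ n κ u l u') u u' (CQ n) (δW n))
    (hcorner : ∀ τ : RestIdx, grp τ = g₀ ↔ τ = cornerIdx)
    (hGrp : ∀ n : ℕ, 2 ≤ n → Odd n → ∀ [NeZero n], ∀ g : G, g ≠ g₀ →
      |∑ b ∈ (univ : Finset (Fin 4 → Fin n)).image resSite, ((n : ℝ) ^ 4)⁻¹ *
        fullSum (fun w : Pt => ∑ τ ∈ (univ : Finset RestIdx).filter (fun τ => grp τ = g),
          restK' n a (gfrz n a b) (cE n) (cΛ n) (cR n) (cK n) (cQ n) (cE₂ n) (cJ4 n) (cΛ₂ n) (cR₂ n) (cQ₂ n) (x₀ n)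
            (WE n) (WJ n) (WΛ n) (WR n) (WQ n) (ωgl n) (ωgh n) ((n : ℝ) ^ 8) N μ ν b τ w)| ≤ CG g) :
    ∀ n : ℕ, 2 ≤ n → Odd n → ∀ [NeZero n],
      |∑ b ∈ (univ : Finset (Fin 4 → Fin n)).image resSite, ((n : ℝ) ^ 4)⁻¹ *
        fullSum (fun w : Pt => ∑ τ ∈ (univ : Finset RestIdx).erase cornerIdx,
          restK' n a (gfrz n a b) (cE n) (cΛ n) (cR n) (cK n) (cQ n) (cE₂ n) (cJ4 n) (cΛ₂ n) (cR₂ n) (cQ₂ n) (x₀ n)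
            (WE n) (WJ n) (WΛ n) (WR n) (WQ n) (ωgl n) (ωgh n) ((n : ℝ) ^ 8) N μ ν b τ w)|
        ≤ ∑ g ∈ (univ : Finset G).erase g₀, CG g := by
  intro n hn hon _
  exact restTot_of_groups n a (cE n) (cΛ n) (cR n) (cK n) (cQ n) (cE₂ n) (cJ4 n) (cΛ₂ n) (cR₂ n) (cQ₂ n) (x₀ n) (ωgl n) (ωgh n)
    ((n : ℝ) ^ 8) N ha (hGa n hn) (fun b => decay_gfrz (hGa n hn) b) (hδW n) (hE n) (hJ n) (hΛ n) (hR n) (hQ n) hμν hcorner (hGrp n hn hon)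

end Packaged

end Summit.QuantumFields.BalabanUV.Beta.D1BFx.RestTotalOfGroups

end
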